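import Summits.QuantumFields.YangMills.Theorems.BalabanUVNodesN06AtRecord11ObligationsSectB

/-!
# BalabanUVNodes ∕ N06 ([B9], `Dag.B9_main`) — OBLIGATIONS OF THE STAGE-11 CERTIFICATE KNIT AT THE RECORD, V:
# the Sect.-B leaf `hB` with the (3.46) block-step carried PER MEMBER `n : Fin 6` (n06-c's `B9SectBStepWhole` v1.1 `StepL2n` ∕ `stepL2_of_members`)

Track A of `YM-PLAN.md` (cell `pub-ymgap`, HUMAN RULING D-0062), node **N06** = [Balaban1985BackgroundPropagators] Thms 3.1–3.15; seat
`pub-ymgap-dag-n06-d` gen 2 = dag-lead N06-ASSIGNMENT v1 (P3) «THE KNIT AT THE RECORD».  Sequel of `BalabanUVNodesN06AtRecord11ObligationsSectB` (p459229), which knits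
`hB` from FOURTEEN block-steps with the L² block (3.46) as ONE step `StepL2` per kernel family.  Seat n06-c's v1.1 (p458681) refines (3.46) to the unit the r06 lineage
actually covers — ONE MEMBER `n : Fin 6` (`StepL2n`; members ₁,₂,₃,₅ ⇐ `B9Ineq346L2Final`, members ₄,₆ OPEN, GAPS G-B9-02 (O′)) — and recombines the six member-steps into
`StepL2` by `stepL2_of_members S` under the sign schema.  AT THE RECORD `S := modelSignsOn_geo9K x.toKIdx` (dag-n03-b), so the refinement transports with `S` DISCHARGED.

WHAT THIS MODULE DOES (kernel bookkeeping BY NAME; 0 `def`, 0 `sorry`, standard axioms; COUNT-NEUTRAL, `--supports` K1 `StabilityBAtRecordR11e`):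
* §1 `hB_obligation_of_memberSteps` — `hB` AT THE RECORD from `StepAnalytic`, `StepE`, SIX `StepL2n … n`, `StepGlob`, `StepH1`, `StepE4`, `StepH2` for K = G′, `StepKer`, and the same
  seven kinds for K = G (twenty-four displayed steps; `S` discharged in both merges).
* §2 `b9_main_of_up_view₁₁B10YZW_of_obligations_W38T314SectBnsupplied` — the chain of record `…_W38T314SectBsupplied` with the two `StepL2` binders REPLACED by the twelve
  member-steps: 23 operator-layer obligations + walk pin ∕ schemas ∕ readings ∕ co-readings ∕ residual + (β)(γ) + 24 Sect.-B steps, displayed and nothing else.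

HONEST FRAMING.  As in the sequel: hypotheses of printed shape; no `OpsY` ∕ `Ops` instance over the record's lattice operators exists in the tree; k stays 0 ∕ 28 in the referee's
sense; N06 is NOT discharged.  One finite four-torus programme at fixed `ε` — NOT ℝ⁴, NOT OS, NOT a mass gap, NOT Clay.  No `def`.
-/

noncomputable section

namespace Summit.QuantumFields.YangMills.BalabanUVNodes.N06AtRecord11ObligationsSectBn

open Literature.MathematicalPhysics.QuantumFieldTheory.Balaban1983to89
open Literature.MathematicalPhysics.QuantumFieldTheory.Balaban1983to89.T4Continuum (T4Family FiniteEpsData)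
open Literature.MathematicalPhysics.QuantumFieldTheory.Balaban1983to89.DagBinding (WorldP leavesP B9LeafX)
open Literature.MathematicalPhysics.QuantumFieldTheory.Balaban1983to89.Node00
open Literature.MathematicalPhysics.QuantumFieldTheory.Balaban1983to89.B9PinMembersKLevelV1 (MemberY geo9Y bg9Y)
open Literature.MathematicalPhysics.QuantumFieldTheory.Balaban1983to89.B9PinGeometryKLevelV1 (dOmegaY OmKY inΛY unitDistY InCubeY c35Y)
open Literature.MathematicalPhysics.QuantumFieldTheory.Balaban1983to89.B7Prop2SpecialUnitary (specialUnitaryUnits)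
open Literature.MathematicalPhysics.QuantumFieldTheory.Balaban1983to89.B9Thm37Whole (Ops Conv342 Sizes StaticOK Local342 Identities const37)
open Literature.MathematicalPhysics.QuantumFieldTheory.Balaban1983to89.B9Cor38Whole (WalkReading Locality W38OfOps)
open Literature.MathematicalPhysics.QuantumFieldTheory.Balaban1983to89.B9Thm37GlueCor36 (CoRealizes)
open Literature.MathematicalPhysics.QuantumFieldTheory.Balaban1983to89.B6RandomWalk (Ineq261)
open Literature.MathematicalPhysics.QuantumFieldTheory.Balaban1983to89.B9Thm34Ext (toB6)
open Literature.MathematicalPhysics.QuantumFieldTheory.Balaban1983to89.B9Thm314 (Thm314LocalPrinted IneqSupF)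
open Literature.MathematicalPhysics.QuantumFieldTheory.Balaban1983to89.B9SectBStepWhole
  (StepE StepL2n StepGlob StepH1 StepE4 StepH2 StepKer StepAnalytic stepL2_of_members)
open Literature.MathematicalPhysics.QuantumFieldTheory.Balaban1983to89.B9GeoNormsKLevelModelSignsV1 (modelSignsOn_geo9K)
open Summit.QuantumFields.YangMills.BalabanUVNodes.N06AtRecord11ObligationsSectB
  (hB_obligation_of_blockSteps b9_main_of_up_view₁₁B10YZW_of_obligations_W38T314SectBsupplied)
open scoped Matrix.Norms.L2Operator

variable {N : ℕ}

/-! ## §1 the `hB` obligation AT THE RECORD with the (3.46) step per member -/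

section AtBundle

variable (θ₃ : Stage3Params) (Mstar : ℕ) (ops : OpsY N θ₃ Mstar)

/-- **THE `hB` OBLIGATION OF THE CERTIFICATE AT THE RECORD'S [B9] BUNDLE WITH THE (3.46) BLOCK-STEP PER MEMBER** (twelve member-steps `StepL2n … n` in place of the two `StepL2` blocks, merged by n06-c's `stepL2_of_members` with `S := modelSignsOn_geo9K`, then the sequel's `hB_obligation_of_blockSteps`) — (Sect. B pp. 400–407: «we can prove all the statements
(3.42)–(3.47) for the operator G′(U′U) … of course with different constants», (3.65)–(3.67) «the inverse satisfies Theorem 3.2», (3.84)–(3.86) for G, Theorem 3.4's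
analytic extension): n06-c's `sectBStepPrinted_of_blockSteps` AT `I := MemberY`, dimension carrier `θ₃.d₆ + 1`, `c35Y`, `geo9Y`, `bg9Y (M_N ℂ) SU(N)`, the layer's
`Gp ∕ GA ∕ Cinv ∕ IsAnalyticExt`, with the sign schema `S := modelSignsOn_geo9K x.toKIdx` DISCHARGED (the genuine lattice norms (3.39)–(3.41); Hölder monotonicity on the bond
arguments only, unused by the merge).  The fourteen block-steps are hypotheses of printed shape; nothing of print asserted.
[cite: Balaban1985BackgroundPropagators, Sect. B (3.50)–(3.86) pp.400–407, Thm 3.4 p.400, (3.42)–(3.48) pp.397–398, (3.39)–(3.41) p.397] -/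
theorem hB_obligation_of_memberSteps
    (hA : StepAnalytic (θ₃.d₆ + 1) c35Y geo9Y (bg9Y (Matrix (Fin N) (Fin N) ℂ) (specialUnitaryUnits (Fin N))) (fun x => (ops x).Gp) (fun x => (ops x).GA)
      (fun x => (ops x).Cinv) (fun x => (ops x).IsAnalyticExt))
    (hEp : StepE (θ₃.d₆ + 1) c35Y geo9Y (bg9Y (Matrix (Fin N) (Fin N) ℂ) (specialUnitaryUnits (Fin N))) (fun x => (ops x).Gp) (fun x => (ops x).GA)
      (fun x => (ops x).Cinv) (fun x => (ops x).Gp))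
    (hLp : ∀ n : Fin 6, StepL2n (θ₃.d₆ + 1) c35Y geo9Y (bg9Y (Matrix (Fin N) (Fin N) ℂ) (specialUnitaryUnits (Fin N))) (fun x => (ops x).Gp) (fun x => (ops x).GA)
      (fun x => (ops x).Cinv) (fun x => (ops x).Gp) n)
    (hGlp : StepGlob (θ₃.d₆ + 1) c35Y geo9Y (bg9Y (Matrix (Fin N) (Fin N) ℂ) (specialUnitaryUnits (Fin N))) (fun x => (ops x).Gp) (fun x => (ops x).GA)
      (fun x => (ops x).Cinv) (fun x => (ops x).Gp))
    (hH1p : StepH1 (θ₃.d₆ + 1) c35Y geo9Y (bg9Y (Matrix (Fin N) (Fin N) ℂ) (specialUnitaryUnits (Fin N))) (fun x => (ops x).Gp) (fun x => (ops x).GA)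
      (fun x => (ops x).Cinv) (fun x => (ops x).Gp))
    (hE4p : StepE4 (θ₃.d₆ + 1) c35Y geo9Y (bg9Y (Matrix (Fin N) (Fin N) ℂ) (specialUnitaryUnits (Fin N))) (fun x => (ops x).Gp) (fun x => (ops x).GA)
      (fun x => (ops x).Cinv) (fun x => (ops x).Gp))
    (hH2p : StepH2 (θ₃.d₆ + 1) c35Y geo9Y (bg9Y (Matrix (Fin N) (Fin N) ℂ) (specialUnitaryUnits (Fin N))) (fun x => (ops x).Gp) (fun x => (ops x).GA)
      (fun x => (ops x).Cinv) (fun x => (ops x).Gp))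
    (hK : StepKer (θ₃.d₆ + 1) c35Y geo9Y (bg9Y (Matrix (Fin N) (Fin N) ℂ) (specialUnitaryUnits (Fin N))) (fun x => (ops x).Gp) (fun x => (ops x).GA)
      (fun x => (ops x).Cinv) (fun x => (ops x).Cinv))
    (hEa : StepE (θ₃.d₆ + 1) c35Y geo9Y (bg9Y (Matrix (Fin N) (Fin N) ℂ) (specialUnitaryUnits (Fin N))) (fun x => (ops x).Gp) (fun x => (ops x).GA)
      (fun x => (ops x).Cinv) (fun x => (ops x).GA))
    (hLa : ∀ n : Fin 6, StepL2n (θ₃.d₆ + 1) c35Y geo9Y (bg9Y (Matrix (Fin N) (Fin N) ℂ) (specialUnitaryUnits (Fin N))) (fun x => (ops x).Gp) (fun x => (ops x).GA)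
      (fun x => (ops x).Cinv) (fun x => (ops x).GA) n)
    (hGla : StepGlob (θ₃.d₆ + 1) c35Y geo9Y (bg9Y (Matrix (Fin N) (Fin N) ℂ) (specialUnitaryUnits (Fin N))) (fun x => (ops x).Gp) (fun x => (ops x).GA)
      (fun x => (ops x).Cinv) (fun x => (ops x).GA))
    (hH1a : StepH1 (θ₃.d₆ + 1) c35Y geo9Y (bg9Y (Matrix (Fin N) (Fin N) ℂ) (specialUnitaryUnits (Fin N))) (fun x => (ops x).Gp) (fun x => (ops x).GA)
      (fun x => (ops x).Cinv) (fun x => (ops x).GA))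
    (hE4a : StepE4 (θ₃.d₆ + 1) c35Y geo9Y (bg9Y (Matrix (Fin N) (Fin N) ℂ) (specialUnitaryUnits (Fin N))) (fun x => (ops x).Gp) (fun x => (ops x).GA)
      (fun x => (ops x).Cinv) (fun x => (ops x).GA))
    (hH2a : StepH2 (θ₃.d₆ + 1) c35Y geo9Y (bg9Y (Matrix (Fin N) (Fin N) ℂ) (specialUnitaryUnits (Fin N))) (fun x => (ops x).Gp) (fun x => (ops x).GA)
      (fun x => (ops x).Cinv) (fun x => (ops x).GA)) :
    B9.SectBStepPrinted (θ₃.d₆ + 1) c35Y geo9Y (bg9Y (Matrix (Fin N) (Fin N) ℂ) (specialUnitaryUnits (Fin N))) (fun x => (ops x).Gp) (fun x => (ops x).GA)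
      (fun x => (ops x).Cinv) (fun x => (ops x).IsAnalyticExt) :=
  -- the implicit carriers are given explicitly (unification from `S` first is a `whnf` time-out otherwise)
  hB_obligation_of_blockSteps θ₃ Mstar ops hA hEp
    (stepL2_of_members (d := θ₃.d₆ + 1) (c35 := c35Y) (geo := geo9Y) (bg := bg9Y (Matrix (Fin N) (Fin N) ℂ) (specialUnitaryUnits (Fin N)))
      (Gp := fun x => (ops x).Gp) (GA := fun x => (ops x).GA) (Cinv := fun x => (ops x).Cinv) (P := fun _ lam => lam.isRight = true)
      (fun x => modelSignsOn_geo9K x.toKIdx) hLp)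
    hGlp hH1p hE4p hH2p hK hEa
    (stepL2_of_members (d := θ₃.d₆ + 1) (c35 := c35Y) (geo := geo9Y) (bg := bg9Y (Matrix (Fin N) (Fin N) ℂ) (specialUnitaryUnits (Fin N)))
      (Gp := fun x => (ops x).Gp) (GA := fun x => (ops x).GA) (Cinv := fun x => (ops x).Cinv) (P := fun _ lam => lam.isRight = true)
      (fun x => modelSignsOn_geo9K x.toKIdx) hLa)
    hGla hH1a hE4a hH2a

end AtBundle

/-! ## §2 THE KNIT AT ₁₁ — the chain of record with the (3.46) steps per member -/

section Pointed

variable [NeZero N] {F : T4Family}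

/-- **THE CHAIN OF RECORD WITH THE (3.46) STEPS PER MEMBER** — the sequel's `…_W38T314SectBsupplied` with its two `StepL2` binders supplied by `stepL2_of_members` from twelve member-steps.  `Dag.B9_main` at every run of a world bound over the four-pin Stage-11
view of the package `(θ, M⋆, ops, ζ, λ_W)` FROM: 23 obligations of `N06AtRecord11CB10YZW.b9_main_of_up_view₁₁B10YZW_of_obligations` verbatim; the walk pin ∕ schemas ∕
readings ∕ locality ∕ co-readings ∕ residual of sequel II, (γ) + (β) of sequel III; and, in place of `hB`, n06-c's fourteen printed block-steps of Sect. B for the layer's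
`Gp ∕ GA ∕ Cinv ∕ IsAnalyticExt` (§1).  Displayed and nothing else; NOT a discharge of N06. [cite: Balaban1985BackgroundPropagators, Thms 3.1–3.15 pp.397–432; Sect. B (3.50)–(3.86) pp.400–407, Thm 3.4 p.400; Thm 3.7 pp.409–410, Cor. 3.8 p.410, Thm 3.14 pp.426–427; Balaban1984PropagatorsII, Lemma 2.1 (2.61) p.234, Props. 2.2–2.7 pp.234–249] -/
theorem b9_main_of_up_view₁₁B10YZW_of_obligations_W38T314SectBnsupplied (θ : Stage11Params F N) (hθ : θ.Admissible) (Mstar : ℕ)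
    (ops : OpsY N θ.toStage3Params Mstar) (ζ : ResidZ F N) (lamW : ResidW F N) (w : WorldP)
    (hup : ∀ P, w.up P = upOfRecord₅C F N (θ.view₁₁B10YZW F N Mstar ops ζ lamW) P)
    (hGp_e : ∀ (x : MemberY θ.d₆ θ.ℓ₆ θ.hd' θ.hL' θ.b₀ θ.b₁ Mstar) (n : Fin 4) (lam : (geo9Y x).Loc) (y : (geo9Y x).Site),
      (ops x).Gp.e n (bg9Y (Matrix (Fin N) (Fin N) ℂ) (specialUnitaryUnits (Fin N)) x).one lam y ≤ (Node00.GpU x.toKIdx).e n lam y)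
    (hGp_h1 : ∀ (x : MemberY θ.d₆ θ.ℓ₆ θ.hd' θ.hL' θ.b₀ θ.b₁ Mstar) (lam : (geo9Y x).Loc) (b : ℝ) (c : (geo9Y x).Cut),
      (ops x).Gp.h1 (bg9Y (Matrix (Fin N) (Fin N) ℂ) (specialUnitaryUnits (Fin N)) x).one lam b c ≤ (Node00.GpU x.toKIdx).h1 lam b c)
    (hC : ∀ (x : MemberY θ.d₆ θ.ℓ₆ θ.hd' θ.hL' θ.b₀ θ.b₁ Mstar) (y y' : (geo9Y x).Site),
      |(ops x).Cinv.ker (bg9Y (Matrix (Fin N) (Fin N) ℂ) (specialUnitaryUnits (Fin N)) x).one y y'| ≤ |(Node00.CinvU x.toKIdx).ker y y'|)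
    (hGA_e : ∀ (x : MemberY θ.d₆ θ.ℓ₆ θ.hd' θ.hL' θ.b₀ θ.b₁ Mstar) (n : Fin 4) (lam : (geo9Y x).Loc) (y : (geo9Y x).Site),
      (ops x).GA.e n (bg9Y (Matrix (Fin N) (Fin N) ℂ) (specialUnitaryUnits (Fin N)) x).one lam y ≤ (Node00.GU x.toKIdx).e n lam y)
    (hGA_h1 : ∀ (x : MemberY θ.d₆ θ.ℓ₆ θ.hd' θ.hL' θ.b₀ θ.b₁ Mstar) (lam : (geo9Y x).Loc) (b : ℝ) (c : (geo9Y x).Cut),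
      (ops x).GA.h1 (bg9Y (Matrix (Fin N) (Fin N) ℂ) (specialUnitaryUnits (Fin N)) x).one lam b c ≤ (Node00.GU x.toKIdx).h1 lam b c)
    (hGA_e4 : ∀ (x : MemberY θ.d₆ θ.ℓ₆ θ.hd' θ.hL' θ.b₀ θ.b₁ Mstar) (lam : (geo9Y x).Loc) (y : (geo9Y x).Site),
      (ops x).GA.e4 (bg9Y (Matrix (Fin N) (Fin N) ℂ) (specialUnitaryUnits (Fin N)) x).one lam y ≤ (Node00.GU x.toKIdx).e4 lam y)
    (hGA_h2 : ∀ (x : MemberY θ.d₆ θ.ℓ₆ θ.hd' θ.hL' θ.b₀ θ.b₁ Mstar) (lam : (geo9Y x).Loc) (b : ℝ) (c : (geo9Y x).Cut),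
      (ops x).GA.h2 (bg9Y (Matrix (Fin N) (Fin N) ℂ) (specialUnitaryUnits (Fin N)) x).one lam b c ≤ (Node00.GU x.toKIdx).h2 lam b c)
    (hGA_l2 : ∀ (x : MemberY θ.d₆ θ.ℓ₆ θ.hd' θ.hL' θ.b₀ θ.b₁ Mstar) (n : Fin 6) (lam : (geo9Y x).Loc) (hc : (geo9Y x).Cut),
      (ops x).GA.l2 n (bg9Y (Matrix (Fin N) (Fin N) ℂ) (specialUnitaryUnits (Fin N)) x).one lam hc ≤ (Node00.GU x.toKIdx).l2 n lam hc)
    (hE4 : ∀ (x : MemberY θ.d₆ θ.ℓ₆ θ.hd' θ.hL' θ.b₀ θ.b₁ Mstar) (lam : (geo9Y x).Loc), ¬ (lam.isRight = true) →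
      ∀ y, (ops x).GA.e4 (bg9Y (Matrix (Fin N) (Fin N) ℂ) (specialUnitaryUnits (Fin N)) x).one lam y ≤ 0)
    (hH2 : ∀ (x : MemberY θ.d₆ θ.ℓ₆ θ.hd' θ.hL' θ.b₀ θ.b₁ Mstar) (lam : (geo9Y x).Loc), ¬ (lam.isRight = true) →
      ∀ (β : ℝ) (c : (geo9Y x).Cut), (ops x).GA.h2 (bg9Y (Matrix (Fin N) (Fin N) ℂ) (specialUnitaryUnits (Fin N)) x).one lam β c ≤ 0)
    (hGp : B9FromB6.ResidualGpAtOne geo9Y (bg9Y (Matrix (Fin N) (Fin N) ℂ) (specialUnitaryUnits (Fin N))) (fun x => (ops x).Gp))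
    (hGA : B9FromB6.ResidualGAGlobAtOne geo9Y (bg9Y (Matrix (Fin N) (Fin N) ℂ) (specialUnitaryUnits (Fin N))) (fun x => (ops x).GA))
    -- in place of `hB`: n06-c's fourteen printed block-steps of Sect. B (§1)
    (hA : StepAnalytic (θ.d₆ + 1) c35Y geo9Y (bg9Y (Matrix (Fin N) (Fin N) ℂ) (specialUnitaryUnits (Fin N))) (fun x => (ops x).Gp) (fun x => (ops x).GA)
      (fun x => (ops x).Cinv) (fun x => (ops x).IsAnalyticExt))
    (hEp : StepE (θ.d₆ + 1) c35Y geo9Y (bg9Y (Matrix (Fin N) (Fin N) ℂ) (specialUnitaryUnits (Fin N))) (fun x => (ops x).Gp) (fun x => (ops x).GA)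
      (fun x => (ops x).Cinv) (fun x => (ops x).Gp))
    (hLp : ∀ n : Fin 6, StepL2n (θ.d₆ + 1) c35Y geo9Y (bg9Y (Matrix (Fin N) (Fin N) ℂ) (specialUnitaryUnits (Fin N))) (fun x => (ops x).Gp) (fun x => (ops x).GA)
      (fun x => (ops x).Cinv) (fun x => (ops x).Gp) n)
    (hGlp : StepGlob (θ.d₆ + 1) c35Y geo9Y (bg9Y (Matrix (Fin N) (Fin N) ℂ) (specialUnitaryUnits (Fin N))) (fun x => (ops x).Gp) (fun x => (ops x).GA)
      (fun x => (ops x).Cinv) (fun x => (ops x).Gp))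
    (hH1p : StepH1 (θ.d₆ + 1) c35Y geo9Y (bg9Y (Matrix (Fin N) (Fin N) ℂ) (specialUnitaryUnits (Fin N))) (fun x => (ops x).Gp) (fun x => (ops x).GA)
      (fun x => (ops x).Cinv) (fun x => (ops x).Gp))
    (hE4p : StepE4 (θ.d₆ + 1) c35Y geo9Y (bg9Y (Matrix (Fin N) (Fin N) ℂ) (specialUnitaryUnits (Fin N))) (fun x => (ops x).Gp) (fun x => (ops x).GA)
      (fun x => (ops x).Cinv) (fun x => (ops x).Gp))
    (hH2p : StepH2 (θ.d₆ + 1) c35Y geo9Y (bg9Y (Matrix (Fin N) (Fin N) ℂ) (specialUnitaryUnits (Fin N))) (fun x => (ops x).Gp) (fun x => (ops x).GA)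
      (fun x => (ops x).Cinv) (fun x => (ops x).Gp))
    (hK : StepKer (θ.d₆ + 1) c35Y geo9Y (bg9Y (Matrix (Fin N) (Fin N) ℂ) (specialUnitaryUnits (Fin N))) (fun x => (ops x).Gp) (fun x => (ops x).GA)
      (fun x => (ops x).Cinv) (fun x => (ops x).Cinv))
    (hEa : StepE (θ.d₆ + 1) c35Y geo9Y (bg9Y (Matrix (Fin N) (Fin N) ℂ) (specialUnitaryUnits (Fin N))) (fun x => (ops x).Gp) (fun x => (ops x).GA)
      (fun x => (ops x).Cinv) (fun x => (ops x).GA))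
    (hLa : ∀ n : Fin 6, StepL2n (θ.d₆ + 1) c35Y geo9Y (bg9Y (Matrix (Fin N) (Fin N) ℂ) (specialUnitaryUnits (Fin N))) (fun x => (ops x).Gp) (fun x => (ops x).GA)
      (fun x => (ops x).Cinv) (fun x => (ops x).GA) n)
    (hGla : StepGlob (θ.d₆ + 1) c35Y geo9Y (bg9Y (Matrix (Fin N) (Fin N) ℂ) (specialUnitaryUnits (Fin N))) (fun x => (ops x).Gp) (fun x => (ops x).GA)
      (fun x => (ops x).Cinv) (fun x => (ops x).GA))
    (hH1a : StepH1 (θ.d₆ + 1) c35Y geo9Y (bg9Y (Matrix (Fin N) (Fin N) ℂ) (specialUnitaryUnits (Fin N))) (fun x => (ops x).Gp) (fun x => (ops x).GA)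
      (fun x => (ops x).Cinv) (fun x => (ops x).GA))
    (hE4a : StepE4 (θ.d₆ + 1) c35Y geo9Y (bg9Y (Matrix (Fin N) (Fin N) ℂ) (specialUnitaryUnits (Fin N))) (fun x => (ops x).Gp) (fun x => (ops x).GA)
      (fun x => (ops x).Cinv) (fun x => (ops x).GA))
    (hH2a : StepH2 (θ.d₆ + 1) c35Y geo9Y (bg9Y (Matrix (Fin N) (Fin N) ℂ) (specialUnitaryUnits (Fin N))) (fun x => (ops x).Gp) (fun x => (ops x).GA)
      (fun x => (ops x).Cinv) (fun x => (ops x).GA))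
    (hg : B9.GaugeReduction335 (θ.d₆ + 1) c35Y geo9Y (bg9Y (Matrix (Fin N) (Fin N) ℂ) (specialUnitaryUnits (Fin N))) InCubeY (fun x => (ops x).Gp)
      (fun x => (ops x).GA) (fun x => (ops x).Cinv))
    -- in place of `t37`, `c38`, `hsum`: as in sequel II
    [∀ x : MemberY θ.d₆ θ.ℓ₆ θ.hd' θ.hL' θ.b₀ θ.b₁ Mstar, Fintype (geo9Y x).Site]
    [∀ x : MemberY θ.d₆ θ.ℓ₆ θ.hd' θ.hL' θ.b₀ θ.b₁ Mstar, DecidableEq (geo9Y x).Site]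
    {X Y ι : MemberY θ.d₆ θ.ℓ₆ θ.hd' θ.hL' θ.b₀ θ.b₁ Mstar → Type}
    [∀ x, Fintype (X x)] [∀ x, DecidableEq (X x)] [∀ x, Fintype (Y x)] [∀ x, DecidableEq (Y x)] [∀ x, Fintype (ι x)]
    (𝔬 : ∀ x, Ops (geo9Y x) (bg9Y (Matrix (Fin N) (Fin N) ℂ) (specialUnitaryUnits (Fin N)) x) (X x) (Y x) (ι x))
    (rd : ∀ x, WalkReading (geo9Y x) (bg9Y (Matrix (Fin N) (Fin N) ℂ) (specialUnitaryUnits (Fin N)) x) (X x) (ι x))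
    (R : MemberY θ.d₆ θ.ℓ₆ θ.hd' θ.hL' θ.b₀ θ.b₁ Mstar → ℝ) (H : MemberY θ.d₆ θ.ℓ₆ θ.hd' θ.hL' θ.b₀ θ.b₁ Mstar → Prop)
    (κ : MemberY θ.d₆ θ.ℓ₆ θ.hd' θ.hL' θ.b₀ θ.b₁ Mstar → Sizes) (d : ℕ) (α ρ Nc N' Cℓ K θ₀ B₀ δ₀ a₁ M₁ ML : ℝ)
    (hα : 0 ≤ α) (hα2 : α ≤ 1 / 2) (hN : 0 ≤ Nc) (hN' : 0 ≤ N') (hCℓ : 1 ≤ Cℓ) (hK0 : 0 ≤ K) (hθ₀ : 0 ≤ θ₀) (hB₀ : 0 < B₀) (hδ₀ : 0 < δ₀)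
    (ha₁ : 0 < a₁) (hM₁ : 0 < M₁)
    (hst : ∀ x, StaticOK (𝔬 x) ρ Nc N' Cℓ (κ x)) (hκ : ∀ x, (κ x).Bounded K θ₀ Cℓ (geo9Y x).M)
    (hrd : ∀ x, (rd x).OK (𝔬 x).blk) (hloc : ∀ x, Locality (𝔬 x) (rd x))
    (h261 : ∀ x, ML ≤ (geo9Y x).M → Ineq261 d (toB6 (geo9Y x) (R x) (H x)) δ₀ α)
    (h36 : ∀ x, M₁ ≤ (geo9Y x).M → ∀ α₀ : ℝ, 0 < α₀ → c35Y * (geo9Y x).M * α₀ ≤ a₁ →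
      ∀ U : (bg9Y (Matrix (Fin N) (Fin N) ℂ) (specialUnitaryUnits (Fin N)) x).Cfg,
        (bg9Y (Matrix (Fin N) (Fin N) ℂ) (specialUnitaryUnits (Fin N)) x).Reg335 c35Y α₀ U →
          Local342 (𝔬 x) (R x) (H x) B₀ δ₀ U ∧ Identities (𝔬 x) (R x) (H x) U)
    (hE38 : ∀ x, (ops x).E37 = W38OfOps (𝔬 x) (rd x) (R x) (H x) (const37 d δ₀ α ρ B₀ Nc N' Cℓ K) ((1 - 2 * α) * δ₀))
    (evY : ∀ x : MemberY θ.d₆ θ.ℓ₆ θ.hd' θ.hL' θ.b₀ θ.b₁ Mstar, (geo9Y x).Loc → Y x → ℝ)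
    (hco0 : ∀ x U, CoRealizes (ops x).Gp 0 U (𝔬 x).blk (𝔬 x).blk (rd x).ev ((𝔬 x).Gp U))
    (hco1 : ∀ x U, CoRealizes (ops x).Gp 1 U (𝔬 x).blkY (𝔬 x).blk (rd x).ev ((𝔬 x).D U ∘ₗ (𝔬 x).Gp U))
    (hco2 : ∀ x U, CoRealizes (ops x).Gp 2 U (𝔬 x).blk (𝔬 x).blkY (evY x) ((𝔬 x).Gp U ∘ₗ (𝔬 x).Dstar U))
    (hco3 : ∀ x U, CoRealizes (ops x).Gp 3 U (𝔬 x).blk (𝔬 x).blk (rd x).ev ((𝔬 x).Lap U ∘ₗ (𝔬 x).Gp U))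
    {B₁ δ₁ : ℝ} (hB₁ : 0 < B₁) (hδ₁ : 0 < δ₁) (hCB : const37 d δ₀ α ρ B₀ Nc N' Cℓ K ≤ B₁) (hδ₁le : δ₁ ≤ (1 - 2 * α) * δ₀)
    {Bβ Bε : ℝ → ℝ} {Bεβ : ℝ → ℝ → ℝ}
    (hrest : ∀ (x : MemberY θ.d₆ θ.ℓ₆ θ.hd' θ.hL' θ.b₀ θ.b₁ Mstar) (U : (bg9Y (Matrix (Fin N) (Fin N) ℂ) (specialUnitaryUnits (Fin N)) x).Cfg),
      ((ops x).E37).Converges U →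
        (∀ (n : Fin 6) (lam : (geo9Y x).Loc) (h : (geo9Y x).Cut) (y y' : (geo9Y x).Site), (geo9Y x).cutIn h y → (geo9Y x).suppIn lam y' →
            (ops x).Gp.l2 n U lam h ≤ B₁ * B9.pref6 ((geo9Y x).len y) n * (geo9Y x).cutSup h * Real.exp (-(δ₁ * (geo9Y x).dist y y')) * (geo9Y x).l2Norm lam) ∧
        (∀ (n : Fin 4) (lam : (geo9Y x).Loc) (γ : ℝ), -4 ≤ γ → γ ≤ 4 → (ops x).Gp.glob n U lam γ ≤ B₁ * (geo9Y x).wNorm γ lam) ∧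
        B9.Ineq343_345 (ops x).Gp Bβ Bε Bεβ δ₁ U)
    (h310 : ∀ (x : MemberY θ.d₆ θ.ℓ₆ θ.hd' θ.hL' θ.b₀ θ.b₁ Mstar) (U : (bg9Y (Matrix (Fin N) (Fin N) ℂ) (specialUnitaryUnits (Fin N)) x).Cfg),
      ((ops x).E310).Converges U → B9.Ineq342_346_347 (ops x).GA B₁ δ₁ U ∧ B9.Ineq343_345 (ops x).GA Bβ Bε Bεβ δ₁ U)
    -- in place of `t314`: (γ) and (β) of sequel III
    (r : ℝ)
    (hgeo : ∀ (x : MemberY θ.d₆ θ.ℓ₆ θ.hd' θ.hL' θ.b₀ θ.b₁ Mstar) (y y' : (geo9Y x).Site), ¬ (OmKY x y ∧ OmKY x y') →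
      dOmegaY x y y' ≤ (geo9Y x).dist y y' + r)
    (hplain : ∃ M₁ δ₁ a₁ B₁ : ℝ, 0 < M₁ ∧ 0 < δ₁ ∧ 0 < a₁ ∧ 0 < B₁ ∧
      ∀ x : MemberY θ.d₆ θ.ℓ₆ θ.hd' θ.hL' θ.b₀ θ.b₁ Mstar, M₁ ≤ (geo9Y x).M → ∀ α₀ : ℝ, 0 < α₀ → (geo9Y x).M * α₀ ≤ a₁ →
        ∀ U : (bg9Y (Matrix (Fin N) (Fin N) ℂ) (specialUnitaryUnits (Fin N)) x).Cfg,
          (bg9Y (Matrix (Fin N) (Fin N) ℂ) (specialUnitaryUnits (Fin N)) x).Reg335 c35Y α₀ U → IneqSupF (ops x).Kdiff B₁ δ₁ (fun _ => True) (fun _ _ => 1) U)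
    -- the remaining printed leaves, verbatim
    (t39 : B9.Thm39Printed (θ.d₆ + 1) c35Y geo9Y (bg9Y (Matrix (Fin N) (Fin N) ℂ) (specialUnitaryUnits (Fin N))) (fun x => (ops x).EK39))
    (t310 : B9.Thm310Printed c35Y geo9Y (bg9Y (Matrix (Fin N) (Fin N) ℂ) (specialUnitaryUnits (Fin N))) (fun x => (ops x).E310))
    (hksum : B9.RWKernelSumYields (θ.d₆ + 1) geo9Y (bg9Y (Matrix (Fin N) (Fin N) ℂ) (specialUnitaryUnits (Fin N))) (fun x => (ops x).EK39)
      (fun x => (ops x).Cinv))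
    (t311 : B9.Thm311Printed c35Y geo9Y (bg9Y (Matrix (Fin N) (Fin N) ℂ) (specialUnitaryUnits (Fin N))) (fun x => (ops x).PosDef))
    (t312 : B9.Thm312Printed (θ.d₆ + 1) c35Y geo9Y (bg9Y (Matrix (Fin N) (Fin N) ℂ) (specialUnitaryUnits (Fin N))) (fun x => (ops x).GD)
      (fun x => (ops x).G₁) (fun x => (ops x).H) (fun x => (ops x).H₁) (fun x => (ops x).HasRWExp) (fun x => (ops x).HasRWExpH)
      (fun x => (ops x).PosDefK))
    (t313 : B9.Thm313Printed c35Y geo9Y (bg9Y (Matrix (Fin N) (Fin N) ℂ) (specialUnitaryUnits (Fin N))) (fun x => (ops x).GG)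
      (fun x => (ops x).HasRWExp) (fun x => (ops x).PosDefK))
    (t315 : B9.Thm315FullPrinted c35Y geo9Y (bg9Y (Matrix (Fin N) (Fin N) ℂ) (specialUnitaryUnits (Fin N))) (fun x => (ops x).Ck) inΛY unitDistY
      (fun x => (ops x).GivenBy3185) (fun x => (ops x).HasRWExpC))
    (s349 : B9.Stmt349Printed (θ.d₆ + 1) c35Y geo9Y (bg9Y (Matrix (Fin N) (Fin N) ℂ) (specialUnitaryUnits (Fin N))) (fun x => (ops x).P349))
    (s3132 : B9.Stmt3132Printed (θ.d₆ + 1) c35Y geo9Y (bg9Y (Matrix (Fin N) (Fin N) ℂ) (specialUnitaryUnits (Fin N))) (fun x => (ops x).QGQinv)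
      (fun x => (ops x).QG1Qinv))
    (t314loc : Thm314LocalPrinted c35Y geo9Y (bg9Y (Matrix (Fin N) (Fin N) ℂ) (specialUnitaryUnits (Fin N))) (fun x => (ops x).Kdiff) OmKY dOmegaY)
    (P : B12.RunParams) : Dag.B9_main (leavesP w P) :=
  b9_main_of_up_view₁₁B10YZW_of_obligations_W38T314SectBsupplied θ hθ Mstar ops ζ lamW w hup hGp_e hGp_h1 hC hGA_e hGA_h1 hGA_e4 hGA_h2 hGA_l2 hE4 hH2
    hGp hGA hA hEp
    (stepL2_of_members (d := θ.d₆ + 1) (c35 := c35Y) (geo := geo9Y) (bg := bg9Y (Matrix (Fin N) (Fin N) ℂ) (specialUnitaryUnits (Fin N)))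
      (Gp := fun x => (ops x).Gp) (GA := fun x => (ops x).GA) (Cinv := fun x => (ops x).Cinv) (P := fun _ lam => lam.isRight = true)
      (fun x => modelSignsOn_geo9K x.toKIdx) hLp)
    hGlp hH1p hE4p hH2p hK hEa
    (stepL2_of_members (d := θ.d₆ + 1) (c35 := c35Y) (geo := geo9Y) (bg := bg9Y (Matrix (Fin N) (Fin N) ℂ) (specialUnitaryUnits (Fin N)))
      (Gp := fun x => (ops x).Gp) (GA := fun x => (ops x).GA) (Cinv := fun x => (ops x).Cinv) (P := fun _ lam => lam.isRight = true)
      (fun x => modelSignsOn_geo9K x.toKIdx) hLa)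
    hGla hH1a hE4a hH2a hg 𝔬 rd R H κ d α ρ Nc N' Cℓ K θ₀ B₀ δ₀ a₁ M₁ ML hα hα2 hN hN' hCℓ hK0 hθ₀ hB₀ hδ₀ ha₁ hM₁ hst hκ hrd hloc h261 h36
    hE38 evY hco0 hco1 hco2 hco3 hB₁ hδ₁ hCB hδ₁le hrest h310 r hgeo hplain t39 t310 hksum t311 t312 t313 t315 s349 s3132 t314loc P

end Pointed

end Summit.QuantumFields.YangMills.BalabanUVNodes.N06AtRecord11ObligationsSectBn

end
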